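import Summits.AtomisticToContinuum.FouriersLaw.Theses.StaticAbelianSqueeze
import Summits.AtomisticToContinuum.FouriersLaw.Theorems.OddSectorIrreversibilityCorrectorTheoryUniformMixing

/-!
# `StaticAbelianSqueeze.KuboAbelIdentity` (stmt-AtomisticToContinuum-13419) holds

The crux `KuboAbelIdentity` of route `StaticAbelianSqueeze` (sub-problem `FouriersLaw` of
`AtomisticToContinuum`) is, up to the `let P := pinnedChain ω₂ lam β γ` abbreviation, conjunct B of
`OddSectorIrreversibility.CorrectorTheory`, proved in
`OddSectorIrreversibilityCorrectorTheoryUniformMixing.lean` (`Corrector.CorrectorTheory_proof`): the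
Kundu–Dhar–Narayan open-chain Green–Kubo identity `(N-1) T² D = ∫₀^∞ c_N(t) dt` for the pinned chain
under weak-NESS uniqueness, for every steady-state family and every response coefficient `D`.

* `kuboAbelIdentity_holds` — the route decl, by projection.

No definitions, no named facts.
-/

namespace Summit.AtomisticToContinuum.FouriersLaw.Theorems.StaticAbelianSqueeze

/-- **`KuboAbelIdentity` holds**: the open-chain Green–Kubo identity of Kundu–Dhar–Narayan for the
pinned anharmonic chain (conjunct B of `OddSectorIrreversibility.CorrectorTheory`).
[cite: KunduDharNarayan2009, p. 3] [cite: CuneoEckmannHairerReyBellet2018, Thm 2.13] -/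
theorem kuboAbelIdentity_holds :
    Summit.AtomisticToContinuum.FouriersLaw.Theses.StaticAbelianSqueeze.KuboAbelIdentity :=
  OddSectorIrreversibility.Corrector.CorrectorTheory_proof.2

end Summit.AtomisticToContinuum.FouriersLaw.Theorems.StaticAbelianSqueeze
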